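import Summits.Ventures.PercRepro.ProfileThreeAverageStep
import Summits.Ventures.PercRepro.ProfileThreeFourLine
import Summits.Ventures.PercRepro.ProfileThreeLineFree

/-!
# PercRepro — THE GOOD-POINT RULE (GZ) FOR THE ROW `q = 3` OF (Π): ITS KERNEL FORM AND WHAT IT IMPLIES
(p10, gen 6; `proofs/P10-Q3-NOSPLIT.md` §4)

A non-loop `z` is a **good point** of `M` at level `u` (`GoodPoint M z u`) if the rank-3 demand of `M` exceeds the
rank-3 demand of `M ∖ z` by at most `C(u,3)` times the number of rank-`u` sets through `z`
(`#levelSet (M ／ z) (u − 1)`).  By the level split this is exactly the induction step: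
`ProfileIneq (M ∖ z) 3 u → ProfileIneq M 3 u` (`profileIneq_three_of_goodPoint`); Theorem A says every point
without split sets is good (`goodPoint_of_noSplit`).  The base: a matroid with at most `u + 3` elements satisfies
the row (`profileIneq_three_of_card_le`: the fat rank-3 sets have no demand there, and the independent triples are
paid by `INDEP₃⁺`, ProfileThreeAverageStep).

THE CONJECTURE (GZ) (`GZRule α u`: every simple matroid on `≥ u + 4` elements has a good point) is the
statement of record of the cell for the row `q = 3` — DATA only (0 failures on the simple matroids on `≤ 9`
elements; the rule «every point of a line with `≥ 3` points, every point if there is none»).  Its consequence is a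
kernel theorem: `GZRule α u → ∀ M, ProfileIneq M 3 u` (`profileIneq_three_of_gzRule`, via the reduction to simple
matroids).  Nothing here asserts (GZ).

* `GoodPoint`, `profileIneq_three_of_goodPoint`, `goodPoint_of_noSplit`;
* `profileIneq_three_of_card_le` — the base `|E| ≤ u + 3`;
* `GZRule`, **`profileIneq_three_of_gzRule_simple`**, **`profileIneq_three_of_gzRule`**;
* `lineFree_delete`, `shortLines_delete`; **`profileIneq_three_of_three_point_lines`** — the row on every finite matroid
  from the simple matroids with a 3-point line and no longer line (Theorem A + the line-free theorem);
* `GZRuleA` — the good-point rule on exactly that class (the open piece of C-039); **`profileIneq_three_of_gzRuleA`**.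
-/

open scoped Matroid

namespace PercRepro.Cogirth

open Finset ThmH Skew Shadow Profile

variable {α : Type} [DecidableEq α] {M : Matroid α} [M.Finite]

/-- **A good point** `z` of `M` at level `u`: the rank-3 demand of `M` exceeds that of `M ∖ z` by at most `C(u,3)`
times the number of rank-`u` sets through `z`. -/
def GoodPoint (M : Matroid α) [M.Finite] (z : α) (u : ℕ) : Prop :=
  ∑ B ∈ Rq M 3, demand M 3 u B ≤
    ∑ B ∈ Rq (M ＼ ({z} : Set α)) 3, demand (M ＼ ({z} : Set α)) 3 u B +
      u.choose 3 * (levelSet (M ／ ({z} : Set α)) (u - 1)).card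

/-- **The induction step at a good point**: `(Π_{3,u})(M ∖ z) ⟹ (Π_{3,u})(M)` (`u ≥ 3`). -/
theorem profileIneq_three_of_goodPoint {z : α} (hz : M.Indep {z}) {u : ℕ} (hu : 3 ≤ u)
    (hgood : GoodPoint M z u) (hdel : ProfileIneq (M ＼ ({z} : Set α)) 3 u) : ProfileIneq M 3 u := by
  have hpos : 0 < u.choose 3 := Nat.choose_pos hu
  rw [profileIneq_iff_demand 3 u hu hpos]
  rw [profileIneq_iff_demand 3 u hu hpos] at hdel
  have hlev := card_levelSet_split hz (u := u) (by omega)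
  unfold GoodPoint at hgood
  rw [hlev]
  nlinarith [hgood, hdel]

/-- **Theorem A as a good-point statement**: a non-loop without split sets is a good point (`u ≥ 4`). -/
theorem goodPoint_of_noSplit {z : α} (hz : M.Indep {z}) {u : ℕ} (hu : 4 ≤ u) (hns : NoSplit M z u) :
    GoodPoint M z u := by
  unfold GoodPoint
  have hpos2 : 0 < (u - 1).choose 2 := Nat.choose_pos (by omega)
  have hcon := (profileIneq_iff_demand 2 (u - 1) (by omega) hpos2).1
    (profileIneq_two_all' (M ／ ({z} : Set α)) (by omega))
  have hA := three_mul_demand_le_of_noSplit hz (by omega) hns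
  have hch : u * (u - 1).choose 2 = 3 * u.choose 3 := by
    have h1 : (u - 1 + 1) * (u - 1).choose 2 = (u - 1 + 1).choose (2 + 1) * (2 + 1) :=
      Nat.add_one_mul_choose_eq (u - 1) 2
    have h2 : u - 1 + 1 = u := by omega
    rw [h2, show (2 : ℕ) + 1 = 3 from rfl] at h1
    omega
  nlinarith [hA, hcon, hch]

/-- The rank-3 sets with at least four elements have no demand when `|E| ≤ u + 3`. -/
theorem demand_eq_zero_of_four_le_card {u : ℕ} (hu : 1 ≤ u) (hn : (gr M).card ≤ u + 3) {B : Finset α} (hB : B ⊆ gr M)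
    (hcard : 4 ≤ B.card) : demand M 3 u B = 0 := by
  unfold demand
  have h1 : (gr M \ B).card = (gr M).card - B.card := card_sdiff_of_subset hB
  have h2 : rk M (gr M \ B) ≤ (gr M \ B).card := by
    unfold rk
    have := M.eRk_le_encard ((gr M \ B : Finset α) : Set α)
    rw [Set.encard_coe_eq_coe_finsetCard] at this
    exact ENat.toNat_le_of_le_coe this
  rw [if_neg (by omega)]

omit [DecidableEq α] in
/-- The independent triples are the three-element rank-3 sets. -/
theorem indepSets_three_eq_filter : indepSets M 3 = (Rq M 3).filter (fun B => B.card = 3) := by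
  ext B
  rw [mem_indepSets, mem_filter, mem_Rq]
  constructor
  · rintro ⟨hBg, hc, hi⟩
    refine ⟨⟨hBg, ?_⟩, hc⟩
    rw [hi.eRk_eq_encard, Set.encard_coe_eq_coe_finsetCard, hc]
  · rintro ⟨⟨hBg, hr⟩, hc⟩
    refine ⟨hBg, hc, ?_⟩
    rw [Matroid.indep_iff_eRk_eq_encard_of_finite (finite_toSet B), hr,
      Set.encard_coe_eq_coe_finsetCard, hc]

/-- **The base of the induction**: a matroid with at most `u + 3` elements satisfies `(Π_{3,u})` (`u ≥ 3`). -/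
theorem profileIneq_three_of_card_le {u : ℕ} (hu : 3 ≤ u) (hn : (gr M).card ≤ u + 3) :
    ProfileIneq M 3 u := by
  have hpos : 0 < u.choose 3 := Nat.choose_pos hu
  rw [profileIneq_iff_demand 3 u hu hpos]
  -- only the triples have demand
  have hsum : ∑ B ∈ Rq M 3, demand M 3 u B = ∑ B ∈ indepSets M 3, demand M 3 u B := by
    rw [indepSets_three_eq_filter, sum_filter]
    apply sum_congr rfl
    intro B hB
    split_ifs with h
    · rfl
    · have hBg : B ⊆ gr M := (mem_Rq.1 hB).1
      have hr : rk M B = 3 := by unfold rk; rw [(mem_Rq.1 hB).2, ENat.toNat_coe]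
      have hle : rk M B ≤ B.card := by
        unfold rk
        have := M.eRk_le_encard (B : Set α)
        rw [Set.encard_coe_eq_coe_finsetCard] at this
        exact ENat.toNat_le_of_le_coe this
      exact demand_eq_zero_of_four_le_card (by omega) hn hBg (by omega)
  -- `INDEP₃⁺` at the base levels
  have hI : Indep3Plus M u := by
    rcases Nat.lt_or_ge (gr M).card (u + 3) with h | h
    · exact indep3Plus_of_card_le hu (by omega)
    · exact indep3Plus_of_card_eq hu (by omega)
  unfold Indep3Plus at hI
  -- `I_u` and `F_u` are disjoint subfamilies of the level set
  have hsub : indepSets M u ∪ fSets M u ⊆ levelSet M u := by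
    intro S hS
    rw [mem_union] at hS
    rw [mem_levelSet]
    rcases hS with hS | hS
    · rw [mem_indepSets] at hS
      refine ⟨hS.1, ?_⟩
      rw [hS.2.2.eRk_eq_encard, Set.encard_coe_eq_coe_finsetCard, hS.2.1]
    · rw [mem_fSets] at hS
      refine ⟨hS.1, ?_⟩
      rw [← coe_rk, hS.2.1]
  have hdisj : Disjoint (indepSets M u) (fSets M u) := by
    rw [disjoint_left]
    intro S h1 h2
    have := (mem_indepSets.1 h1).2.1
    have := (mem_fSets.1 h2).2.2.1
    omega
  have hcard : (indepSets M u).card + (fSets M u).card ≤ (levelSet M u).card := by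
    rw [← card_union_of_disjoint hdisj]
    exact card_le_card hsub
  rw [hsum]
  calc ∑ B ∈ indepSets M 3, demand M 3 u B ≤ u.choose 3 * ((indepSets M u).card + (fSets M u).card) := hI
    _ ≤ u.choose 3 * (levelSet M u).card := Nat.mul_le_mul_left _ hcard

/-- **THE GOOD-POINT RULE (GZ), kernel form**: every simple matroid on at least `u + 4` elements has a good
non-loop point at level `u`.  A CONJECTURE of the cell (data only); not asserted here. -/
def GZRule (α : Type) [DecidableEq α] (u : ℕ) : Prop :=
  ∀ (N : Matroid α) [N.Finite], Simple' N → u + 4 ≤ (gr N).card → ∃ z, N.Indep {z} ∧ GoodPoint N z u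

/-- **(GZ) ⟹ the row `q = 3` on every simple matroid** (`u ≥ 3`), by strong induction on `|E|`. -/
theorem profileIneq_three_of_gzRule_simple {u : ℕ} (hu : 3 ≤ u) (h : GZRule α u) (M : Matroid α) [M.Finite]
    (hs : Simple' M) : ProfileIneq M 3 u := by
  suffices hh : ∀ n : ℕ, ∀ (N : Matroid α) [N.Finite], (gr N).card = n → Simple' N → ProfileIneq N 3 u from
    hh _ M rfl hs
  intro n
  induction n using Nat.strong_induction_on with
  | _ n ih =>
  intro N _ hN hsN
  rcases Nat.lt_or_ge (gr N).card (u + 4) with hsmall | hbig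
  · exact profileIneq_three_of_card_le hu (by omega)
  · obtain ⟨z, hz, hgood⟩ := h N hsN hbig
    have hzE : z ∈ gr N := mem_gr_of_indep hz
    have hlt : ((gr N).erase z).card < n := by rw [← hN]; exact card_erase_lt_of_mem hzE
    apply profileIneq_three_of_goodPoint hz hu hgood
    exact ih _ hlt (N ＼ ({z} : Set α)) (by rw [gr_delete']) (simple'_delete hsN z)

/-- **(GZ) ⟹ the row `q = 3` on every finite matroid** (`u ≥ 4`), with the reduction to simple matroids. -/
theorem profileIneq_three_of_gzRule {u : ℕ} (hu : 4 ≤ u) (h : GZRule α u) (M : Matroid α) [M.Finite] :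
    ProfileIneq M 3 u :=
  profileIneq_three_of_simple (by omega) (fun N _ hs => profileIneq_three_of_gzRule_simple (by omega) h N hs) M


/-! ### The reduction to the simple matroids with a 3-point line and no longer line -/

/-- Deleting a point preserves «every rank-2 set has at most `k` points». -/
theorem shortLines_delete {k : ℕ} (h : ∀ L ⊆ gr M, rk M L = 2 → L.card ≤ k) (z : α) :
    ∀ L ⊆ gr (M ＼ ({z} : Set α)), rk (M ＼ ({z} : Set α)) L = 2 → L.card ≤ k := by
  intro L hL hr
  rw [gr_delete'] at hL
  rw [rk_delete hL] at hr
  exact h L (hL.trans (erase_subset z _)) hr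

/-- **THE ROW `q = 3` ON EVERY FINITE MATROID FROM THE SIMPLE MATROIDS WITH A 3-POINT LINE AND NO LONGER LINE**
(`u ≥ 4`): the line-free simple matroids satisfy the row outright (`profileIneq_three_of_lineFree`), and the rest
is Theorem A's reduction. -/
theorem profileIneq_three_of_three_point_lines {u : ℕ} (hu : 4 ≤ u)
    (hS : ∀ (N : Matroid α) [N.Finite], Simple' N → (∀ L ⊆ gr N, rk N L = 2 → L.card ≤ 3) →
      (∃ L ⊆ gr N, rk N L = 2 ∧ L.card = 3) → ProfileIneq N 3 u)
    (M : Matroid α) [M.Finite] : ProfileIneq M 3 u := by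
  apply profileIneq_three_of_simple_short_lines hu
  intro N _ hs hshort
  by_cases hlf : LineFree N
  · exact profileIneq_three_of_lineFree hs hlf hu
  · apply hS N hs hshort
    by_contra hno
    apply hlf
    intro L hL hr
    by_contra hc
    exact hno ⟨L, hL, hr, by have := hshort L hL hr; omega⟩

/-- **THE GOOD-POINT RULE ON THE OPEN CLASS** (the piece of C-039 that is still open): every simple matroid on
`≥ u + 4` elements with a 3-point line and no longer line has a good non-loop point at level `u`.  A CONJECTURE
(data only); not asserted here. -/
def GZRuleA (α : Type) [DecidableEq α] (u : ℕ) : Prop :=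
  ∀ (N : Matroid α) [N.Finite], Simple' N → (∀ L ⊆ gr N, rk N L = 2 → L.card ≤ 3) →
    (∃ L ⊆ gr N, rk N L = 2 ∧ L.card = 3) → u + 4 ≤ (gr N).card → ∃ z, N.Indep {z} ∧ GoodPoint N z u

/-- **`GZRuleA` ⟹ the row `q = 3` on every finite matroid** (`u ≥ 4`). -/
theorem profileIneq_three_of_gzRuleA {u : ℕ} (hu : 4 ≤ u) (h : GZRuleA α u) (M : Matroid α) [M.Finite] :
    ProfileIneq M 3 u := by
  apply profileIneq_three_of_simple_short_lines hu
  suffices hh : ∀ n : ℕ, ∀ (N : Matroid α) [N.Finite], (gr N).card = n → Simple' N →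
      (∀ L ⊆ gr N, rk N L = 2 → L.card ≤ 3) → ProfileIneq N 3 u from fun N _ hs hshort => hh _ N rfl hs hshort
  intro n
  induction n using Nat.strong_induction_on with
  | _ n ih =>
  intro N _ hN hsN hshort
  by_cases hlf : LineFree N
  · exact profileIneq_three_of_lineFree hsN hlf hu
  · rcases Nat.lt_or_ge (gr N).card (u + 4) with hsmall | hbig
    · exact profileIneq_three_of_card_le (by omega) (by omega)
    · have hline : ∃ L ⊆ gr N, rk N L = 2 ∧ L.card = 3 := by
        by_contra hno
        apply hlf
        intro L hL hr
        by_contra hc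
        exact hno ⟨L, hL, hr, by have := hshort L hL hr; omega⟩
      obtain ⟨z, hz, hgood⟩ := h N hsN hshort hline hbig
      have hzE : z ∈ gr N := mem_gr_of_indep hz
      have hlt : ((gr N).erase z).card < n := by rw [← hN]; exact card_erase_lt_of_mem hzE
      apply profileIneq_three_of_goodPoint hz (by omega) hgood
      exact ih _ hlt (N ＼ ({z} : Set α)) (by rw [gr_delete']) (simple'_delete hsN z) (shortLines_delete hshort z)

end PercRepro.Cogirth
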